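import Literature.Probability.LatticeModels.IsingMultiCrossing
import Literature.Probability.LatticeModels.IsingAnnulusCircuit
import Literature.Probability.LatticeModels.FKIsingAnnulusCrossingRSW
import HarnessLib

/-!
# One `+` crossing of a band of stacked annuli costs `(1 - c')^{m+1}`: the one-arm input of the successive conditioning

Topic `Literature/Probability/LatticeModels` (trunk `StatMech`, family `crit-ising`). This file
supplies the hypothesis `hbase` of the generic successive-conditioning bound
`isingMeasure_real_plusArms_le_pow_mul` (`IsingMultiCrossing.lean`) for the critical Ising model on
`ℤ²`, in the geometry of Kemppainen–Smirnov's verification of Condition G for spin interfaces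
(Ann. Probab. 45 (2017), Rem. 2.10 and §4.1.6; Chelkak–Duminil-Copin–Hongler–Kemppainen–Smirnov,
C. R. Math. 352 (2014), §2 Rem. 4) combined with the multi-scale product of Duminil-Copin–Smirnov
(Clay Math. Proc. 15 (2012), Thm. 6.1, eq. (6.2)): for a region `U` whose insulating frontier is
`−` (`PlusInsulated`), stacked square annuli `x₀ + S_{nᵢ, 29nᵢ}` (`nᵢ₊₁ ≥ 29 nᵢ`, `i ≤ m`)
inside the insulating set, sources `In` inside all of them and targets `Out` outside all of them,

  `μ^ξ_{U;β_c,0}(plusCrossing U In Out) ≤ (1 - c')^{m+1}`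

(`isingMeasure_real_plusCrossing_le_pow_of_insulated`), where `c' > 0` is the constant of the
bc-uniform annulus bound `isingMeasure_fixed_real_plusStarCrossing_le` (`IsingAnnulusCircuit.lean`,
from `fkIsing_rsw` through the Edwards–Sokal coupling).

Proof ("(6.1) uniformly in the configuration outside, hence (6.2)" for ONE arm, spin version):
a local `+` path from `In` to `Out` contains, for each `i`, a `+` path of `U` inside the level band
`[6nᵢ - 1, 12nᵢ + 1]` from level `6nᵢ - 1` to level `12nᵢ + 1` (`exists_walk_in_band`); these
events are determined by disjoint level bands, so their probabilities multiply by successive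
conditioning on nested volumes (`isingMeasure_fixed_biInter_le_prod_of_support`, the
Friedli–Velenik consistency, with the per-scale bound required only on the support); each factor
is the probability of a `+` crossing of the annulus `i` inside `Q = U ∩ S_{nᵢ,29nᵢ}` under a
boundary condition equal to `ξ` off `U` — by insulation `−1` at every annulus site adjacent to
`Q` from outside `Q` — which (locality of the boundary condition,
`isingMeasure_fixed_congr_of_eqOn_outerBoundary`; the extension device for `−` boundary spins,
`isingMeasure_fixed_real_le_of_minus_on_sdiff`: removing `−` conditioning only helps an
increasing event, FKG) is at most the probability of a `+∗`-crossing of the full annulus under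
some boundary condition, `≤ 1 - c'`. Everything is proved; no definitions besides the band event.

## References

* A. Kemppainen, S. Smirnov, Ann. Probab. 45 (2017), Rem. 2.10, §4.1.6 (arXiv:1212.6215).
  [KemppainenSmirnov2017]
* H. Duminil-Copin, S. Smirnov, Clay Math. Proc. 15 (2012), §6.1, Thm. 6.1, (6.1)–(6.2).
  [DuminilCopinSmirnov2012Clay]
* D. Chelkak, H. Duminil-Copin, C. Hongler, A. Kemppainen, S. Smirnov, C. R. Math. Acad. Sci.
  Paris 352 (2014), §2 Rem. 4. [CDHKSCRAS2014]
* S. Friedli, Y. Velenik, *Statistical Mechanics of Lattice Systems* (2017), Lemma 6.7,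
  eq. (3.26), Thm. 3.50. [FriedliVelenik2017]
-/

noncomputable section

namespace Literature.Probability.LatticeModels

open MeasureTheory Finset SimpleGraph
open scoped ENNReal

/-! ### Generic tools: locality in the boundary condition, the `−` extension device, products over scales -/

section Generic

variable {V : Type*} (G : SimpleGraph V) [DecidableEq V] [G.LocallyFinite]

/-- **Locality of `μ^η_Λ(A)` in the boundary condition** (Friedli–Velenik 2017, eq. (3.26)): for
an event `A` determined by the spins of `Λ`, `μ^η_{Λ;β,h}(A)` depends on `η` only through its
restriction to the outer boundary `∂ᵉˣΛ`. [cite: FriedliVelenik2017, §3.6.3, eq. (3.26)] -/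
theorem isingMeasure_fixed_congr_of_eqOn_outerBoundary (Λ : Finset V) (β h : ℝ) {η η' : SpinConfig V}
    (hbd : ∀ y ∈ outerBoundary G Λ, η y = η' y) {A : Set (SpinConfig V)} (hA : MeasurableSet A)
    (hAdet : ∀ σ₁ σ₂ : SpinConfig V, (∀ x ∈ Λ, σ₁ x = σ₂ x) → (σ₁ ∈ A ↔ σ₂ ∈ A)) :
    isingMeasure G Λ β h (.fixed η) A = isingMeasure G Λ β h (.fixed η') A := by
  classical
  rw [isingMeasure_apply_of_measurableSet G Λ β h (.fixed η) hA,
    isingMeasure_apply_of_measurableSet G Λ β h (.fixed η') hA,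
    isingPartitionFunction_fixed_congr_outerBoundary G hbd β h]
  congr 2
  have hglue : ∀ τ : Λ → ℤˣ, glue Λ τ (.fixed η) ∈ A ↔ glue Λ τ (.fixed η') ∈ A := fun τ ↦
    hAdet _ _ fun x hx ↦ by rw [glue_apply_of_mem _ _ _ hx, glue_apply_of_mem _ _ _ hx]
  rw [Finset.sum_filter, Finset.sum_filter]
  refine Finset.sum_congr rfl fun τ _ ↦ ?_
  rw [isingWeight_fixed_congr_outerBoundary G hbd β h τ]
  by_cases hτ : glue Λ τ (.fixed η) ∈ A
  · rw [if_pos hτ, if_pos ((hglue τ).1 hτ)]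
  · rw [if_neg hτ, if_neg (fun h' ↦ hτ ((hglue τ).2 h'))]

omit [DecidableEq V] [G.LocallyFinite] in
/-- `{σ | σ = -1 on S}` is a decreasing event. [folklore] -/
theorem isLowerSet_forall_mem_eq_neg_one (S : Finset V) :
    IsLowerSet {σ : SpinConfig V | ∀ x ∈ S, σ x = -1} := by
  intro σ₁ σ₂ hle h x hx
  exact le_antisymm ((h x hx) ▸ hle x) (neg_one_le_intUnits _)

omit [DecidableEq V] [G.LocallyFinite] in
/-- `{σ | σ = -1 on S}` is measurable. [folklore] -/
theorem measurableSet_forall_mem_eq_neg_one (S : Finset V) :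
    MeasurableSet {σ : SpinConfig V | ∀ x ∈ S, σ x = -1} :=
  measurableSet_of_determined S fun σ₁ σ₂ h ↦ forall₂_congr fun x hx ↦ by rw [h x hx]

/-- **Extension device, `−` version** (the "we can add boundary … and ignore the part outside"
step of Kemppainen–Smirnov 2017, §4.1.6, for the Ising model): let `Q ⊆ W` be finite volumes,
`β ≥ 0`, and let the boundary condition `η` be `−1` on `W ∖ Q` and agree with `ζ` off `W`. Then
for every increasing measurable event `E`, `μ^{η}_{Q;β,h}(E) ≤ μ^{ζ}_{W;β,h}(E)`: conditioning
`μ^ζ_W` on the decreasing event `{σ = −1 on W ∖ Q}` produces `μ^η_Q` (consistency), and FKG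
bounds the conditional probability of the increasing `E` by the unconditional one.
[cite: KemppainenSmirnov2017, Rem. 2.10 and §4.1.6] -/
theorem isingMeasure_fixed_real_le_of_minus_on_sdiff [Countable V] {β : ℝ} (hβ : 0 ≤ β) (h : ℝ)
    {Q W : Finset V} (hQW : Q ⊆ W) {η ζ : SpinConfig V} (hηW : ∀ x ∈ W, x ∉ Q → η x = -1)
    (hagree : ∀ x ∉ W, η x = ζ x) {E : Set (SpinConfig V)} (hE : IsUpperSet E)
    (hEm : MeasurableSet E) :
    (isingMeasure G Q β h (.fixed η)).real E ≤ (isingMeasure G W β h (.fixed ζ)).real E := by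
  classical
  set P : Set (SpinConfig V) := {σ | ∀ x ∈ W \ Q, σ x = -1} with hP
  have hPlow : IsLowerSet P := isLowerSet_forall_mem_eq_neg_one (W \ Q)
  have hPm : MeasurableSet P := measurableSet_forall_mem_eq_neg_one (W \ Q)
  have hPdet : ∀ σ₁ σ₂ : SpinConfig V, (∀ x ∉ Q, σ₁ x = σ₂ x) → (σ₁ ∈ P ↔ σ₂ ∈ P) := by
    intro σ₁ σ₂ hσ
    simp only [hP, Set.mem_setOf_eq]
    refine forall₂_congr fun x hx ↦ ?_
    rw [hσ x (Finset.mem_sdiff.1 hx).2]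
  set μW := isingMeasure G W β h (.fixed ζ) with hμW
  set μQ := isingMeasure G Q β h (.fixed η) with hμQ
  -- consistency: `μ_W(E ∩ P) = μ_Q(E) μ_W(P)`
  have hcons : μW (E ∩ P) = μQ E * μW P := by
    rw [hμW, ← lintegral_isingMeasure_fixed_consistent G hQW β h ζ (hEm.inter hPm)]
    simp_rw [isingMeasure_fixed_inter_of_determined_off G Q β h _ hEm hPm hPdet]
    have hae := ae_eqOn_compl_isingMeasure_fixed G W β h ζ
    have heq : ∀ᵐ σ ∂isingMeasure G W β h (.fixed ζ),
        P.indicator (fun _ ↦ isingMeasure G Q β h (.fixed σ) E) σ = P.indicator (fun _ ↦ μQ E) σ := by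
      filter_upwards [hae] with σ hσ
      by_cases hσP : σ ∈ P
      · rw [Set.indicator_of_mem hσP, Set.indicator_of_mem hσP, hμQ]
        refine isingMeasure_fixed_congr_of_eqOn_compl G Q β h (fun x hx ↦ ?_) hEm
        by_cases hxW : x ∈ W
        · rw [hσP x (Finset.mem_sdiff.2 ⟨hxW, hx⟩), hηW x hxW hx]
        · rw [hσ x hxW, hagree x hxW]
      · rw [Set.indicator_of_notMem hσP, Set.indicator_of_notMem hσP]
    rw [lintegral_congr_ae heq, lintegral_indicator hPm, setLIntegral_const]
  -- positivity of `μ_W(P)`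
  have hPpos : 0 < μW.real P := by
    have hmem : glue W (fun _ ↦ -1) (.fixed ζ) ∈ P := fun x hx ↦ by
      rw [glue_apply_of_mem _ _ _ (Finset.mem_sdiff.1 hx).1]
    have hsing := isingMeasure_apply_singleton_holds G W β h (.fixed ζ) (fun _ ↦ -1)
    have hpos : 0 < μW.real {glue W (fun _ ↦ -1) (.fixed ζ)} := by
      rw [measureReal_def, hμW, hsing, ENNReal.toReal_ofReal (div_nonneg (isingWeight_pos G W β h _ _).le
        (isingPartitionFunction_pos G W β h _).le)]
      exact div_pos (isingWeight_pos G W β h _ _) (isingPartitionFunction_pos G W β h _)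
    exact hpos.trans_le (measureReal_mono (Set.singleton_subset_iff.2 hmem))
  -- FKG and division
  have hfkg := isingMeasure_real_inter_le_mul_of_isLowerSet_of_isUpperSet G hβ W h (.fixed ζ) hPlow hE hPm hEm
  have hreal : μW.real (P ∩ E) = μQ.real E * μW.real P := by
    rw [Set.inter_comm, measureReal_def, hcons, ENNReal.toReal_mul, ← measureReal_def, ← measureReal_def]
  rw [hreal, mul_comm (μW.real P)] at hfkg
  exact le_of_mul_le_mul_right hfkg hPpos

/-- **Successive conditioning over nested volumes, the per-scale bounds being required only on the
support** (the product over scales, Kemppainen–Smirnov 2017, p. 11 of arXiv:1212.6215; DCS 2012,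
eq. (6.2)): let `Λ_0 ⊆ Λ_1 ⊆ ⋯` be finite volumes inside a master volume `Λ∞` with boundary
condition `η∞`, `F_i` measurable events with `F_{i+1}` determined by the spins off `Λ_i`, and
`μ^ζ_{Λ_i;β,h}(F_i) ≤ ε_i` for every `ζ` agreeing with `η∞` off `Λ∞`. Then
`μ^η_{Λ_m;β,h}(⋂_{i ≤ m} F_i) ≤ ∏_{i ≤ m} ε_i` for every `η` agreeing with `η∞` off `Λ∞`.
[cite: KemppainenSmirnov2017, Prop. 3.5 (proof)] -/
theorem isingMeasure_fixed_biInter_le_prod_of_support [Countable V] (Λs : ℕ → Finset V)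
    (hmono : ∀ i, Λs i ⊆ Λs (i + 1)) {Λinf : Finset V} (hΛ : ∀ i, Λs i ⊆ Λinf) (ηinf : SpinConfig V)
    (β h : ℝ) (F : ℕ → Set (SpinConfig V)) (hFm : ∀ i, MeasurableSet (F i))
    (hFdet : ∀ i, ∀ σ₁ σ₂ : SpinConfig V, (∀ x ∉ Λs i, σ₁ x = σ₂ x) → (σ₁ ∈ F (i + 1) ↔ σ₂ ∈ F (i + 1)))
    (ε : ℕ → ℝ≥0∞)
    (hε : ∀ i (ζ : SpinConfig V), (∀ x ∉ Λinf, ζ x = ηinf x) → isingMeasure G (Λs i) β h (.fixed ζ) (F i) ≤ ε i)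
    (m : ℕ) (η : SpinConfig V) (hη : ∀ x ∉ Λinf, η x = ηinf x) :
    isingMeasure G (Λs m) β h (.fixed η) (⋂ i ∈ Finset.range (m + 1), F i) ≤ ∏ i ∈ Finset.range (m + 1), ε i := by
  induction m generalizing η with
  | zero => simpa using hε 0 η hη
  | succ m ih =>
    have hmeas : MeasurableSet (⋂ i ∈ Finset.range (m + 1), F i) :=
      MeasurableSet.biInter (Finset.range (m + 1)).countable_toSet fun i _ ↦ hFm i
    rw [Finset.range_add_one, Finset.set_biInter_insert, Finset.prod_insert Finset.notMem_range_self,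
      Set.inter_comm]
    have hε' : ∀ ζ : SpinConfig V, (∀ x ∉ Λs (m + 1), ζ x = η x) →
        isingMeasure G (Λs m) β h (.fixed ζ) (⋂ i ∈ Finset.range (m + 1), F i) ≤ ∏ i ∈ Finset.range (m + 1), ε i :=
      fun ζ hζ ↦ ih ζ fun x hx ↦ (hζ x fun h' ↦ hx (hΛ _ h')).trans (hη x hx)
    calc isingMeasure G (Λs (m + 1)) β h (.fixed η) ((⋂ i ∈ Finset.range (m + 1), F i) ∩ F (m + 1))
        ≤ (∏ i ∈ Finset.range (m + 1), ε i) * isingMeasure G (Λs (m + 1)) β h (.fixed η) (F (m + 1)) :=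
          isingMeasure_fixed_inter_le_mul_of_support G (hmono m) β h η hmeas (hFm (m + 1)) (hFdet m) hε'
      _ ≤ (∏ i ∈ Finset.range (m + 1), ε i) * ε (m + 1) := by gcongr; exact hε (m + 1) η hη
      _ = ε (m + 1) * ∏ i ∈ Finset.range (m + 1), ε i := mul_comm _ _

omit [DecidableEq V] [G.LocallyFinite] in
/-- Along a walk of a graph whose adjacency forces a property at both endpoints, the property
propagates from the start to every vertex of the support. [folklore] -/
theorem Walk.forall_support_of_adj_imp {H : SimpleGraph V} {P : V → Prop}
    (hH : ∀ ⦃u v : V⦄, H.Adj u v → P v) {x y : V} (p : H.Walk x y) (hx : P x) :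
    ∀ v ∈ p.support, P v := by
  induction p with
  | nil => simpa using hx
  | cons hadj _ ih =>
    intro v hv
    rw [SimpleGraph.Walk.support_cons, List.mem_cons] at hv
    rcases hv with rfl | hv
    · exact hx
    · exact ih (hH hadj) v hv

end Generic

/-! ### The band-crossing event of one annulus and its cost -/

section Band

variable (U : Finset (Site 2)) (x₀ : Site 2) (n : ℕ)

/-- **The band `+` crossing of the annulus `x₀ + S_{n,29n}` inside the region `U`**: two sites of
sup-levels exactly `6n - 1` and `12n + 1` about `x₀` joined by a lattice path of `+` sites of `U`
all of whose sites have level in `[6n - 1, 12n + 1]` (the shape produced by `exists_walk_in_band`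
from any local `+` path across the annulus). [cite: DuminilCopinSmirnov2012Clay, §6.1] -/
def bandPlusCross : Set (SpinConfig (Site 2)) :=
  {σ | ∃ u v : Site 2, supLevel x₀ u = 6 * n - 1 ∧ supLevel x₀ v = 12 * n + 1 ∧
    (SimpleGraph.fromRel fun s t ↦ (plusGraph (zdGraph 2) U σ).Adj s t ∧
      6 * (n : ℤ) - 1 ≤ supLevel x₀ s ∧ supLevel x₀ s ≤ 12 * n + 1 ∧
      6 * (n : ℤ) - 1 ≤ supLevel x₀ t ∧ supLevel x₀ t ≤ 12 * n + 1).Reachable u v}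

variable {U x₀ n}

/-- The band graph only depends on the spins of the sites of `U` in the annulus (`n ≥ 1`). [folklore] -/
theorem bandGraph_eq_of_agree (hn : 1 ≤ n) {σ₁ σ₂ : SpinConfig (Site 2)}
    (h : ∀ x ∈ U ∩ annulusInterior x₀ n, σ₁ x = σ₂ x) :
    (SimpleGraph.fromRel fun s t ↦ (plusGraph (zdGraph 2) U σ₁).Adj s t ∧
      6 * (n : ℤ) - 1 ≤ supLevel x₀ s ∧ supLevel x₀ s ≤ 12 * n + 1 ∧
      6 * (n : ℤ) - 1 ≤ supLevel x₀ t ∧ supLevel x₀ t ≤ 12 * n + 1) =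
    (SimpleGraph.fromRel fun s t ↦ (plusGraph (zdGraph 2) U σ₂).Adj s t ∧
      6 * (n : ℤ) - 1 ≤ supLevel x₀ s ∧ supLevel x₀ s ≤ 12 * n + 1 ∧
      6 * (n : ℤ) - 1 ≤ supLevel x₀ t ∧ supLevel x₀ t ≤ 12 * n + 1) := by
  have hmem : ∀ s, s ∈ U → 6 * (n : ℤ) - 1 ≤ supLevel x₀ s → supLevel x₀ s ≤ 12 * n + 1 →
      s ∈ U ∩ annulusInterior x₀ n := fun s hs h1 h2 ↦
    Finset.mem_inter.2 ⟨hs, mem_annulusInterior.2 ⟨by omega, by omega⟩⟩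
  have key : ∀ {σ₁ σ₂ : SpinConfig (Site 2)}, (∀ x ∈ U ∩ annulusInterior x₀ n, σ₁ x = σ₂ x) →
      ∀ s t, ((plusGraph (zdGraph 2) U σ₁).Adj s t ∧
        6 * (n : ℤ) - 1 ≤ supLevel x₀ s ∧ supLevel x₀ s ≤ 12 * n + 1 ∧
        6 * (n : ℤ) - 1 ≤ supLevel x₀ t ∧ supLevel x₀ t ≤ 12 * n + 1) →
      ((plusGraph (zdGraph 2) U σ₂).Adj s t ∧
        6 * (n : ℤ) - 1 ≤ supLevel x₀ s ∧ supLevel x₀ s ≤ 12 * n + 1 ∧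
        6 * (n : ℤ) - 1 ≤ supLevel x₀ t ∧ supLevel x₀ t ≤ 12 * n + 1) := by
    intro σ₁ σ₂ h s t ⟨⟨hG, hs, ht, hs1, ht1⟩, h1, h2, h3, h4⟩
    exact ⟨⟨hG, hs, ht, (h s (hmem s hs h1 h2)) ▸ hs1, (h t (hmem t ht h3 h4)) ▸ ht1⟩, h1, h2, h3, h4⟩
  ext s t
  simp only [SimpleGraph.fromRel_adj]
  constructor
  · rintro ⟨hne, h' | h'⟩
    · exact ⟨hne, Or.inl (key h s t h')⟩
    · exact ⟨hne, Or.inr (key h t s h')⟩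
  · rintro ⟨hne, h' | h'⟩
    · exact ⟨hne, Or.inl (key (fun x hx ↦ (h x hx).symm) s t h')⟩
    · exact ⟨hne, Or.inr (key (fun x hx ↦ (h x hx).symm) t s h')⟩

/-- The band crossing is determined by the spins of the sites of `U` in the annulus (`n ≥ 1`). [folklore] -/
theorem bandPlusCross_determined (hn : 1 ≤ n) (σ₁ σ₂ : SpinConfig (Site 2))
    (h : ∀ x ∈ U ∩ annulusInterior x₀ n, σ₁ x = σ₂ x) :
    σ₁ ∈ bandPlusCross U x₀ n ↔ σ₂ ∈ bandPlusCross U x₀ n := by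
  simp only [bandPlusCross, Set.mem_setOf_eq, bandGraph_eq_of_agree hn h]

/-- The band crossing is measurable. [folklore] -/
theorem measurableSet_bandPlusCross (hn : 1 ≤ n) : MeasurableSet (bandPlusCross U x₀ n) :=
  measurableSet_of_determined (U ∩ annulusInterior x₀ n) (bandPlusCross_determined hn)

/-- The band crossing is increasing. [folklore] -/
theorem isUpperSet_bandPlusCross : IsUpperSet (bandPlusCross U x₀ n) := by
  rintro σ₁ σ₂ hle ⟨u, v, hu, hv, hr⟩
  refine ⟨u, v, hu, hv, hr.mono ?_⟩
  intro s t hst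
  rw [SimpleGraph.fromRel_adj] at hst ⊢
  refine ⟨hst.1, hst.2.imp ?_ ?_⟩
  · rintro ⟨h1, h2⟩; exact ⟨plusGraph_mono hle h1, h2⟩
  · rintro ⟨h1, h2⟩; exact ⟨plusGraph_mono hle h1, h2⟩

/-- **A band `+` crossing is a `+∗`-crossing of the annulus `{6n ≤ ‖· - x₀‖_∞ ≤ 12n}`** (a
lattice path is a `∗`-path). [cite: GeorgiiHiguchi2000, §2 p. 4] -/
theorem bandPlusCross_subset_plusStarCrossing : bandPlusCross U x₀ n ⊆ plusStarCrossing x₀ n := by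
  classical
  rintro σ ⟨u, v, hu, hv, hr⟩
  obtain ⟨p⟩ := hr
  set H := SimpleGraph.fromRel fun s t ↦ (plusGraph (zdGraph 2) U σ).Adj s t ∧
      6 * (n : ℤ) - 1 ≤ supLevel x₀ s ∧ supLevel x₀ s ≤ 12 * n + 1 ∧
      6 * (n : ℤ) - 1 ≤ supLevel x₀ t ∧ supLevel x₀ t ≤ 12 * n + 1 with hH
  have hle : H ≤ zdStarGraph := by
    intro s t hst
    rw [hH, SimpleGraph.fromRel_adj] at hst
    rcases hst.2 with h' | h'
    · exact zdGraph_le_zdStarGraph h'.1.1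
    · exact zdGraph_le_zdStarGraph h'.1.1.symm
  have hplus : ∀ ⦃s t : Site 2⦄, H.Adj s t → σ t = 1 := by
    intro s t hst
    rw [hH, SimpleGraph.fromRel_adj] at hst
    rcases hst.2 with h' | h'
    · exact h'.1.2.2.2.2
    · exact h'.1.2.2.2.1
  -- the start is `+` (the walk is not trivial: levels differ)
  have hu1 : σ u = 1 := by
    cases p with
    | nil => omega
    | cons hadj _ =>
      rw [hH, SimpleGraph.fromRel_adj] at hadj
      rcases hadj.2 with h' | h'
      · exact h'.1.2.2.2.1
      · exact h'.1.2.2.2.2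
  refine ⟨p.support.toFinset, fun z hz ↦ ?_, u, v, p.mapLe hle, by omega, by omega, fun z hz ↦ ?_⟩
  · exact Walk.forall_support_of_adj_imp hplus p hu1 z (List.mem_toFinset.1 hz)
  · simp only [SimpleGraph.Walk.support_mapLe_eq_support] at hz
    exact List.mem_toFinset.2 hz

/-- **A local `+` path across the annulus contains a band crossing** (discrete intermediate
values of the sup-level along a lattice path). [folklore] -/
theorem bandPlusCross_of_reachable (hn : 1 ≤ n) {σ : SpinConfig (Site 2)} {a b : Site 2}
    (ha : supLevel x₀ a ≤ 6 * n - 1) (hb : 12 * (n : ℤ) + 1 ≤ supLevel x₀ b)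
    (hab : (plusGraph (zdGraph 2) U σ).Reachable a b) : σ ∈ bandPlusCross U x₀ n := by
  obtain ⟨u, v, hu, hv, hr⟩ := exists_walk_in_band (H := plusGraph (zdGraph 2) U σ) (supLevel x₀)
    (fun s t hst ↦ supLevel_le_of_adj x₀ hst.1) (a := 6 * n - 1) (b := 12 * n + 1) (by omega) ha hb hab
  exact ⟨u, v, hu, hv, hr⟩

/-- **One band crossing inside an insulated region costs `1 - c'`.** Let `n ≥ 1`, let every site
of the open annulus `{n < ‖· - x₀‖_∞ < 29n}` lie in the insulating set `T₀`, let `ξ` be insulated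
for `U` and let `σ` agree with `ξ` off `U`. If `μ^ζ_{S;β_c,0}(plusStarCrossing) ≤ 1 - c'` for the
full annulus `S = annulusInterior x₀ n` and every `ζ`, then
`μ^σ_{U ∩ S;β_c,0}(bandPlusCross U x₀ n) ≤ 1 - c'`: the annulus sites adjacent to `U ∩ S` from
outside are off `U`, hence `−1` (insulation); replacing `σ` by `−1` on all of `S ∖ U` does not
change the measure (locality) and then un-conditioning the `−` spins only increases the
probability of the increasing crossing event (extension device), which in the full annulus is a
`+∗`-crossing. [cite: KemppainenSmirnov2017, Rem. 2.10 and §4.1.6] -/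
theorem isingMeasure_real_bandPlusCross_le (hn : 1 ≤ n) {c' : ℝ}
    (hann : ∀ ζ : SpinConfig (Site 2),
      (isingMeasure (zdGraph 2) (annulusInterior x₀ n) criticalBetaTwo 0 (.fixed ζ)).real (plusStarCrossing x₀ n) ≤ 1 - c')
    {T₀ : Set (Site 2)} (hT₀ : ∀ v ∈ annulusInterior x₀ n, v ∈ T₀) {ξ σ : SpinConfig (Site 2)}
    (hins : PlusInsulated (zdGraph 2) T₀ U ξ) (hσ : ∀ x ∉ U, σ x = ξ x) :
    (isingMeasure (zdGraph 2) (U ∩ annulusInterior x₀ n) criticalBetaTwo 0 (.fixed σ)).real (bandPlusCross U x₀ n) ≤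
      1 - c' := by
  classical
  set S := annulusInterior x₀ n with hS
  set Q := U ∩ S with hQ
  set σ' := overrideOn (S \ Q) (fun _ ↦ (-1 : ℤˣ)) σ with hσ'
  have hEm := measurableSet_bandPlusCross (U := U) (x₀ := x₀) hn
  -- (1) locality: replace `σ` by `−1` on `S ∖ Q`
  have hloc : (isingMeasure (zdGraph 2) Q criticalBetaTwo 0 (.fixed σ)).real (bandPlusCross U x₀ n) =
      (isingMeasure (zdGraph 2) Q criticalBetaTwo 0 (.fixed σ')).real (bandPlusCross U x₀ n) := by
    simp only [measureReal_def]
    rw [isingMeasure_fixed_congr_of_eqOn_outerBoundary (zdGraph 2) Q criticalBetaTwo 0 (η := σ) (η' := σ')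
      (fun y hy ↦ ?_) hEm (bandPlusCross_determined hn)]
    obtain ⟨hyQ, x, hxQ, hxy⟩ := mem_outerBoundary_iff.1 hy
    by_cases hyS : y ∈ S \ Q
    · -- an annulus site off `U` adjacent to `U`: insulated
      rw [hσ', overrideOn_of_mem _ _ hyS]
      have hyU : y ∉ U := fun hyU ↦ (Finset.mem_sdiff.1 hyS).2 (Finset.mem_inter.2 ⟨hyU, (Finset.mem_sdiff.1 hyS).1⟩)
      rw [hσ y hyU]
      exact hins y (hT₀ y (Finset.mem_sdiff.1 hyS).1) hyU ⟨x, (Finset.mem_inter.1 hxQ).1, hxy.symm⟩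
    · rw [hσ', overrideOn_of_notMem _ _ hyS]
  rw [hloc]
  -- (2) extension device and (3) the full annulus
  calc (isingMeasure (zdGraph 2) Q criticalBetaTwo 0 (.fixed σ')).real (bandPlusCross U x₀ n)
      ≤ (isingMeasure (zdGraph 2) S criticalBetaTwo 0 (.fixed σ')).real (bandPlusCross U x₀ n) :=
        isingMeasure_fixed_real_le_of_minus_on_sdiff (zdGraph 2) criticalBetaTwo_pos.le 0 Finset.inter_subset_right
          (fun x hxS hxQ ↦ by rw [hσ', overrideOn_of_mem _ _ (Finset.mem_sdiff.2 ⟨hxS, hxQ⟩)]) (fun _ _ ↦ rfl)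
          isUpperSet_bandPlusCross hEm
    _ ≤ (isingMeasure (zdGraph 2) S criticalBetaTwo 0 (.fixed σ')).real (plusStarCrossing x₀ n) :=
        measureReal_mono bandPlusCross_subset_plusStarCrossing
    _ ≤ 1 - c' := hann σ'

end Band

/-! ### The one-arm bound: a `+` crossing of `m + 1` stacked annuli inside an insulated region -/

section Stack

/-- **One `+` crossing of `m + 1` stacked annuli inside an insulated region costs `(1 - c')^{m+1}`**
(the hypothesis `hbase` of `isingMeasure_real_plusArms_le_pow_mul` for the critical Ising model on
`ℤ²`; Kemppainen–Smirnov 2017, Rem. 2.10 / §4.1.6 with the product over concentric annuli of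
p. 11; DCS 2012, eq. (6.2)). Assuming `fkIsing_rsw`, there is `c' ∈ (0, 1]` such that: for every
centre `x₀`, scales `n 0 ≥ 1`, `n (i+1) ≥ 29 n i`, every `m`, every insulating set `T₀` containing
the open annuli `{n i < ‖· - x₀‖_∞ < 29 n i}`, `i ≤ m`, sources `In` at level `≤ 6 n 0 - 1`, targets
`Out` at level `≥ 12 n m + 1`, every region `U` and every boundary condition `ξ` insulated for `U`,
`μ^ξ_{U;β_c,0}(plusCrossing U In Out) ≤ (1 - c')^{m+1}`. [cite: KemppainenSmirnov2017, Rem. 2.10]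
[cite: DuminilCopinSmirnov2012Clay, Thm. 6.1 (proof, eq. (6.2))] -/
theorem isingMeasure_real_plusCrossing_le_pow_of_insulated (h₁ : fkIsing_rsw) :
    ∃ c' : ℝ, 0 < c' ∧ c' ≤ 1 ∧ ∀ (x₀ : Site 2) (n : ℕ → ℕ), 1 ≤ n 0 → (∀ i, 29 * n i ≤ n (i + 1)) →
      ∀ (m : ℕ) (T₀ : Set (Site 2)), (∀ i ≤ m, ∀ v ∈ annulusInterior x₀ (n i), v ∈ T₀) →
      ∀ (In Out U : Finset (Site 2)), (∀ a ∈ In, supLevel x₀ a ≤ 6 * n 0 - 1) →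
        (∀ b ∈ Out, 12 * (n m : ℤ) + 1 ≤ supLevel x₀ b) →
      ∀ ξ : SpinConfig (Site 2), PlusInsulated (zdGraph 2) T₀ U ξ →
        (isingMeasure (zdGraph 2) U criticalBetaTwo 0 (.fixed ξ)).real (plusCrossing (zdGraph 2) U In Out) ≤
          (1 - c') ^ (m + 1) := by
  classical
  obtain ⟨c', hc', hann⟩ := isingMeasure_fixed_real_plusStarCrossing_le h₁ (fkIsing_annulusCrossing_le_of_fkIsing_rsw h₁)
  have hc'1 : c' ≤ 1 := by
    have h0 : (0 : ℝ) ≤ 1 - c' := measureReal_nonneg.trans (hann 0 1 le_rfl 1)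
    linarith
  refine ⟨c', hc', hc'1, fun x₀ n hn0 hsep m T₀ hT₀ In Out U hIn hOut ξ hins ↦ ?_⟩
  -- monotonicity of the scales
  have hnpos : ∀ i, 1 ≤ n i := by
    intro i
    induction i with
    | zero => exact hn0
    | succ i ih => have := hsep i; omega
  have hnmono : ∀ i j, i ≤ j → n i ≤ n j := by
    intro i j hij
    induction hij with
    | refl => exact le_rfl
    | @step k _ ih => exact ih.trans (show n k ≤ n (k + 1) by have := hsep k; omega)
  -- nested volumes and band events
  set Λs : ℕ → Finset (Site 2) := fun i ↦ U.filter fun v ↦ supLevel x₀ v < 29 * n i with hΛs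
  set F : ℕ → Set (SpinConfig (Site 2)) := fun i ↦ bandPlusCross U x₀ (n i) with hF
  have hmonoΛ : ∀ i, Λs i ⊆ Λs (i + 1) := by
    intro i v hv
    simp only [hΛs, Finset.mem_filter] at hv ⊢
    have := hsep i
    exact ⟨hv.1, by omega⟩
  have hΛU : ∀ i, Λs i ⊆ U := fun i ↦ Finset.filter_subset _ _
  have hFm : ∀ i, MeasurableSet (F i) := fun i ↦ measurableSet_bandPlusCross (hnpos i)
  have hFdet : ∀ i, ∀ σ₁ σ₂ : SpinConfig (Site 2), (∀ x ∉ Λs i, σ₁ x = σ₂ x) → (σ₁ ∈ F (i + 1) ↔ σ₂ ∈ F (i + 1)) := by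
    intro i σ₁ σ₂ h
    refine bandPlusCross_determined (hnpos (i + 1)) σ₁ σ₂ fun x hx ↦ h x fun hxΛ ↦ ?_
    have hlev := (mem_annulusInterior.1 (Finset.mem_inter.1 hx).2).1
    have hlt := (Finset.mem_filter.1 hxΛ).2
    have := hsep i
    omega
  -- the crossing forces every band event
  have hsub : plusCrossing (zdGraph 2) U In Out ⊆ ⋂ i ∈ Finset.range (m + 1), F i := by
    rintro σ ⟨a, haIn, haU, ha1, b, hbOut, hab⟩
    simp only [Set.mem_iInter, Finset.mem_range]
    intro i hi
    have hi' : i ≤ m := Nat.lt_succ_iff.1 hi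
    refine bandPlusCross_of_reachable (hnpos i) ?_ ?_ hab
    · have := hIn a haIn; have := hnmono 0 i (Nat.zero_le i); omega
    · have := hOut b hbOut; have := hnmono i m hi'; omega
  -- per-scale bound on the support (only the annuli `i ≤ m` matter)
  set ε : ℕ → ℝ≥0∞ := fun i ↦ if i ≤ m then ENNReal.ofReal (1 - c') else ⊤ with hεdef
  have hε : ∀ i (ζ : SpinConfig (Site 2)), (∀ x ∉ U, ζ x = ξ x) →
      isingMeasure (zdGraph 2) (Λs i) criticalBetaTwo 0 (.fixed ζ) (F i) ≤ ε i := by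
    intro i ζ hζ
    by_cases hi : i ≤ m
    swap
    · simp [hεdef, hi]
    rw [hεdef]; dsimp only; rw [if_pos hi]
    have hQΛ : U ∩ annulusInterior x₀ (n i) ⊆ Λs i := by
      intro v hv
      obtain ⟨hvU, hvA⟩ := Finset.mem_inter.1 hv
      exact Finset.mem_filter.2 ⟨hvU, (mem_annulusInterior.1 hvA).2⟩
    have key := isingMeasure_fixed_inter_le_mul_of_support (zdGraph 2) hQΛ criticalBetaTwo 0 ζ (hFm i)
      MeasurableSet.univ (B := Set.univ) (fun _ _ _ ↦ Iff.rfl) (ε := ENNReal.ofReal (1 - c')) fun σ hσ ↦ by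
        have hσU : ∀ x ∉ U, σ x = ξ x := fun x hx ↦ (hσ x fun h' ↦ hx (hΛU i h')).trans (hζ x hx)
        have hreal := isingMeasure_real_bandPlusCross_le (hnpos i) (hann x₀ (n i) (hnpos i)) (hT₀ i hi) hins hσU
        rw [← ENNReal.ofReal_toReal (measure_ne_top _ _)]
        exact ENNReal.ofReal_le_ofReal hreal
    simpa using key
  -- product over the scales, under `μ^ζ_{Λ_m}` for `ζ = ξ` off `U`, then under `μ^ξ_U`
  have hprod : ∀ ζ : SpinConfig (Site 2), (∀ x ∉ U, ζ x = ξ x) →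
      isingMeasure (zdGraph 2) (Λs m) criticalBetaTwo 0 (.fixed ζ) (⋂ i ∈ Finset.range (m + 1), F i) ≤
        ENNReal.ofReal (1 - c') ^ (m + 1) := by
    intro ζ hζ
    have h1 := isingMeasure_fixed_biInter_le_prod_of_support (zdGraph 2) Λs hmonoΛ hΛU ξ criticalBetaTwo 0 F hFm
      hFdet ε hε m ζ hζ
    have hprodε : ∏ i ∈ Finset.range (m + 1), ε i = ENNReal.ofReal (1 - c') ^ (m + 1) := by
      rw [Finset.prod_congr rfl fun i hi ↦ ?_, Finset.prod_const, Finset.card_range]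
      rw [hεdef]; dsimp only; rw [if_pos (Nat.lt_succ_iff.1 (Finset.mem_range.1 hi))]
    rwa [hprodε] at h1
  have hmeas : MeasurableSet (⋂ i ∈ Finset.range (m + 1), F i) :=
    MeasurableSet.biInter (Finset.range (m + 1)).countable_toSet fun i _ ↦ hFm i
  have hU : isingMeasure (zdGraph 2) U criticalBetaTwo 0 (.fixed ξ) (⋂ i ∈ Finset.range (m + 1), F i) ≤
      ENNReal.ofReal (1 - c') ^ (m + 1) := by
    have key := isingMeasure_fixed_inter_le_mul_of_support (zdGraph 2) (hΛU m) criticalBetaTwo 0 ξ hmeas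
      MeasurableSet.univ (B := Set.univ) (fun _ _ _ ↦ Iff.rfl) (ε := ENNReal.ofReal (1 - c') ^ (m + 1)) hprod
    simpa using key
  have hfin := (measure_mono hsub).trans hU
  have h0 : (0 : ℝ) ≤ 1 - c' := by linarith
  calc (isingMeasure (zdGraph 2) U criticalBetaTwo 0 (.fixed ξ)).real (plusCrossing (zdGraph 2) U In Out)
      = (isingMeasure (zdGraph 2) U criticalBetaTwo 0 (.fixed ξ) (plusCrossing (zdGraph 2) U In Out)).toReal := rfl
    _ ≤ (ENNReal.ofReal (1 - c') ^ (m + 1)).toReal :=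
        ENNReal.toReal_mono (ENNReal.pow_ne_top ENNReal.ofReal_ne_top) hfin
    _ = (1 - c') ^ (m + 1) := by rw [ENNReal.toReal_pow, ENNReal.toReal_ofReal h0]

end Stack

end Literature.Probability.LatticeModels

end
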